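import Summits.CriticalPhenomena.SAWScalingLimit.Theorems.SAWExpCovarianceRotationsFromExp

/-!
# Line `birth` — registered skeleton for the crux `DensityTheorem` (stmt-CriticalPhenomena-6756)

Crux (FIXED; rank 4 of `route-CriticalPhenomena-SAWExpCovariance`, decl
`Summit.CriticalPhenomena.SAWScalingLimit.Theses.SAWExpCovariance.DensityTheorem`), DENS, pure continuum:
a chordal family `P` on Dobrushin domains which
(hCD) sees a domain only through `(carrier, a, b)`,
(hSim) is covariant under `z ↦ r z + w`, `r > 0`,
(hExp) is covariant under `exp` on every Dobrushin `U` with `exp` injective on `closure U`, and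
(hDC) is disc-continuous (Radó/Fréchet continuity along conformal images of the disc converging uniformly on
the CLOSED disc, marked points at `∓1`),
is conformally covariant (`ChordalFamily.IsConformallyCovariant`).

## The cut (the route header's own two-layer plan "RotationsFromExp-type step → LoewnerWordApproximation →
## closure step", with the grounder/refuter notes of 2026-08-15 on this item)

Write `Δ` for any Dobrushin domain with carrier the unit disc and marked points `Δ.pt 0 = -1`, `Δ.pt 1 = 1`,
and call `(D, Φ)` a DISC MAP when `Φ : C(ℂ, ℂ)` agrees on the open disc with a conformal equivalence onto
`D.carrier` and `D.pt 0 = Φ (-1)`, `D.pt 1 = Φ 1` (these are literally the data of the crux's hDC clause).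

* S1 `stub_discReduction` — ONE MAP PER DOMAIN IS ENOUGH: if `P D = Φ_* (P Δ)` for every disc map `(D, Φ)`
  and every such `Δ`, then `P` is conformally covariant. (Riemann mapping theorem for Jordan domains and
  Carathéodory's continuous extension to the closed disc — both PROVED in the tree,
  `exists_conformalEquiv_ball_holds`, `JordanDomain.exists_continuousOn_closedBall_extension_holds`,
  `JordanDomain.isSimplyConnected_holds`; a disc automorphism sending `∓1` to the two preimages of `a, b`;
  a continuous extension to `ℂ`; `g.HasBoundaryValue` at `a, b` + continuity of `Φ` force `Φ a = a'`,
  `Φ b = b'`; functoriality `(Φ ∘ Ψ)_* = Φ_* Ψ_*`.) True for EVERY `P`; size M.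
* S2 `stub_discLimitClosure` — DISC COVARIANCE PASSES TO CLOSED-DISC-UNIFORM LIMITS: for chordal,
  disc-continuous `P`, if disc maps `(Dₙ, Φₙ)` with `P Dₙ = (Φₙ)_* P Δ` converge to a disc map `(D, Φ)`
  uniformly on the closed disc, then `P D = Φ_* P Δ`. (hDC gives `P Dₙ ⇒ P D`; `P Δ` is carried by curves in
  the closed disc (chordality), on which `Φₙ → Φ` uniformly, so `(Φₙ)_* P Δ ⇒ Φ_* P Δ` by dominated
  convergence; weak limits of probability measures on the metric space `CurveClass ℂ` are unique.) Size M.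
* S3 `stub_expAffineWordDensity` (LOAD-BEARING, `P`-FREE) — DENSITY OF THE EXP-AFFINE PSEUDOGROUP: for every
  relation `W U V Φ` between Dobrushin domains and plane maps which contains the similarities
  (`W U (σ U) σ`), the exponential on exp-injective closures (`W U V exp`, `V = exp U`), its inverses
  (`W V U L` for any continuous `L` with `L ∘ exp = id` on `closure U`), and is closed under composition,
  under replacing source/target by Dobrushin domains with the same `(carrier, a, b)`, and under changing the
  map off `closure U`, EVERY disc map `(D, Φ)` is a closed-disc-uniform limit of disc maps `(Dₙ, Φₙ)` with
  `W Δ Dₙ Φₙ`. (Plan of the route: radial Loewner maps with piecewise-constant driving are finite words in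
  Möbius maps, `z²`, `√z` — i.e. in similarities, `exp`, `log` on admissible closed sub-domains (Koebe
  `k(z) = z/(1+z)²`); driver continuity (Lawler 2005 Prop. 4.47) and density of slit maps in class `S`
  (Lawler 2005 Lemma 4.24 / Rem. 4.25; Duren 1983 §3.2–3.3) give words `g_N → ψ` locally uniformly on the
  open disc; `Φ_N := g_N (r_N ·)`, `r_N ↑ 1`, converges uniformly on the CLOSED disc because `Φ` is uniformly
  continuous there; `D_N := Φ_N(𝔻)` is an analytic Jordan domain.) NOT in the tree: radial Loewner ODE,
  slit-map density, driver continuity. Size L–XL. This is the crux's own why-might-fail (bookkeeping of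
  admissible closed domains letter by letter).

`DensityTheorem_of` (kernel-checked, no `sorry` of its own) is a genuine assembly: it upgrades hSim to all
complex similarities by the tree theorem `rotationsFromExp_proof` (support item RotationsFromExp,
stmt-CriticalPhenomena-6759, proved), proves IN THIS FILE that the covariance class
`W_P U V Φ := (P V = Φ_* P U)` of a chordal, carrier-determined, similarity- and exp-covariant family obeys
the six closure rules of S3 (the `log` rule is hExp + chordality; composition is `Measure.map_map` +
measurability of `CurveClass.map` along continuous maps, proved here by Heine–Cantor; locality is
chordality; congruence is hCD), feeds S3's approximants to S2, and hands the resulting disc covariance to S1.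

Disproof used: none relevant — `ledger crux ls stmt-CriticalPhenomena-6756` had no workfiles before this one
(no `Disproof.lean`, no `_false_without_` theorem); negatives index (11 entries, 2026-08-17): none is a
pseudogroup-density / covariance-upgrade statement (stmt-0698 `SymmetryUpgrade` concerns local-Markov
families and D₄ data, not exp-covariance + disc-continuity).
-/

noncomputable section

open MeasureTheory Filter Topology Set
open Literature.Probability.RandomPlanarGeometry

namespace Summit.CriticalPhenomena.SAWScalingLimit.Cruxes.DensityTheorem.Birth

/-! ### Vocabulary of the line (documentation and the `_holds` consistency checks only; the stubs below are
stated in TREE VOCABULARY so that each lands verbatim as a `Theorems/…` file `--supports stmt-CriticalPhenomena-6756`) -/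

/-- The exponential map as an element of `C(ℂ, ℂ)` (the term used by the crux). -/
abbrev expC : C(ℂ, ℂ) := ⟨Complex.exp, Complex.continuous_exp⟩

/-- hCD of the crux: `P` sees a Dobrushin domain only through `(carrier, a, b)`. -/
def CarrierDetermined (P : ChordalFamily) : Prop :=
  ∀ (D D' : DobrushinDomain), D.carrier = D'.carrier → D.pt 0 = D'.pt 0 → D.pt 1 = D'.pt 1 → P D = P D'

/-- hExp of the crux: covariance under `exp` on exp-injective closures. -/
def ExpCovariant (P : ChordalFamily) : Prop :=
  ∀ (U V : DobrushinDomain), Set.InjOn Complex.exp (closure U.carrier) →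
    V.carrier = Complex.exp '' U.carrier → V.pt 0 = Complex.exp (U.pt 0) → V.pt 1 = Complex.exp (U.pt 1) →
      P V = (P U).map (CurveClass.map expC)

/-- hDC of the crux: disc-continuity (Radó/Fréchet continuity along conformal images of the disc converging
uniformly on the closed disc, marked points at `∓1`). -/
def DiscContinuous (P : ChordalFamily) : Prop :=
  ∀ (Dn : ℕ → DobrushinDomain) (D : DobrushinDomain) (Φn : ℕ → C(ℂ, ℂ)) (Φ : C(ℂ, ℂ)),
    (∀ n, ∃ g : ConformalEquiv (Metric.ball (0 : ℂ) 1) (Dn n).carrier, Set.EqOn (Φn n) g (Metric.ball (0 : ℂ) 1)) →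
    (∃ g : ConformalEquiv (Metric.ball (0 : ℂ) 1) D.carrier, Set.EqOn Φ g (Metric.ball (0 : ℂ) 1)) →
    (∀ n, (Dn n).pt 0 = Φn n (-1) ∧ (Dn n).pt 1 = Φn n 1) → D.pt 0 = Φ (-1) → D.pt 1 = Φ 1 →
    TendstoUniformlyOn (fun n => ((Φn n : C(ℂ, ℂ)) : ℂ → ℂ)) (Φ : ℂ → ℂ) Filter.atTop (Metric.closedBall (0 : ℂ) 1) →
    ∀ f : BoundedContinuousFunction (CurveClass ℂ) ℝ,
      Filter.Tendsto (fun n => ∫ γ, f γ ∂(P (Dn n))) Filter.atTop (nhds (∫ γ, f γ ∂(P D)))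

/-- Disc covariance of `P`: one (Riemann) map per domain. -/
def DiscCovariant (P : ChordalFamily) : Prop :=
  ∀ (Δ D : DobrushinDomain) (Φ : C(ℂ, ℂ)), Δ.carrier = Metric.ball (0 : ℂ) 1 → Δ.pt 0 = -1 → Δ.pt 1 = 1 →
    (∃ g : ConformalEquiv (Metric.ball (0 : ℂ) 1) D.carrier, Set.EqOn Φ g (Metric.ball (0 : ℂ) 1)) →
    D.pt 0 = Φ (-1) → D.pt 1 = Φ 1 → P D = (P Δ).map (CurveClass.map Φ)

/-- The six closure rules of S3 for a relation `W U V Φ` ("`Φ` carries `U` to `V`"). -/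
def IsExpAffineClosed (W : DobrushinDomain → DobrushinDomain → C(ℂ, ℂ) → Prop) : Prop :=
  (∀ (U : DobrushinDomain) (c : ℂ) (hc : c ≠ 0) (w : ℂ),
      W U (U.map (similarity c hc w)) (similarity c hc w : C(ℂ, ℂ))) ∧
  (∀ (U V : DobrushinDomain), Set.InjOn Complex.exp (closure U.carrier) →
      V.carrier = Complex.exp '' U.carrier → V.pt 0 = Complex.exp (U.pt 0) → V.pt 1 = Complex.exp (U.pt 1) →
        W U V expC) ∧
  (∀ (U V : DobrushinDomain) (L : C(ℂ, ℂ)), Set.InjOn Complex.exp (closure U.carrier) →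
      V.carrier = Complex.exp '' U.carrier → V.pt 0 = Complex.exp (U.pt 0) → V.pt 1 = Complex.exp (U.pt 1) →
        (∀ z ∈ closure U.carrier, L (Complex.exp z) = z) → W V U L) ∧
  (∀ (U V V' : DobrushinDomain) (Φ Ψ : C(ℂ, ℂ)), W U V Φ → W V V' Ψ → W U V' (Ψ.comp Φ)) ∧
  (∀ (U U' V V' : DobrushinDomain) (Φ : C(ℂ, ℂ)), W U V Φ →
      U.carrier = U'.carrier → U.pt 0 = U'.pt 0 → U.pt 1 = U'.pt 1 →
      V.carrier = V'.carrier → V.pt 0 = V'.pt 0 → V.pt 1 = V'.pt 1 → W U' V' Φ) ∧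
  (∀ (U V : DobrushinDomain) (Φ Φ' : C(ℂ, ℂ)), W U V Φ → Set.EqOn Φ Φ' (closure U.carrier) → W U V Φ')

/-- **S1, named.** Disc covariance implies conformal covariance, for every family. -/
def DiscReduction : Prop :=
  ∀ P : ChordalFamily, DiscCovariant P → P.IsConformallyCovariant

/-- **S2, named.** For chordal disc-continuous families, disc covariance passes to closed-disc-uniform limits
of disc maps. -/
def DiscLimitClosure : Prop :=
  ∀ P : ChordalFamily, P.IsChordal → DiscContinuous P →
    ∀ (Δ : DobrushinDomain) (Dn : ℕ → DobrushinDomain) (D : DobrushinDomain) (Φn : ℕ → C(ℂ, ℂ)) (Φ : C(ℂ, ℂ)),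
      Δ.carrier = Metric.ball (0 : ℂ) 1 → Δ.pt 0 = -1 → Δ.pt 1 = 1 →
      (∀ n, ∃ g : ConformalEquiv (Metric.ball (0 : ℂ) 1) (Dn n).carrier, Set.EqOn (Φn n) g (Metric.ball (0 : ℂ) 1)) →
      (∃ g : ConformalEquiv (Metric.ball (0 : ℂ) 1) D.carrier, Set.EqOn Φ g (Metric.ball (0 : ℂ) 1)) →
      (∀ n, (Dn n).pt 0 = Φn n (-1) ∧ (Dn n).pt 1 = Φn n 1) → D.pt 0 = Φ (-1) → D.pt 1 = Φ 1 →
      TendstoUniformlyOn (fun n => ((Φn n : C(ℂ, ℂ)) : ℂ → ℂ)) (Φ : ℂ → ℂ) Filter.atTop (Metric.closedBall (0 : ℂ) 1) →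
      (∀ n, P (Dn n) = (P Δ).map (CurveClass.map (Φn n))) →
      P D = (P Δ).map (CurveClass.map Φ)

/-- **S3, named.** Density of the exp-affine pseudogroup among disc maps, uniformly on the closed disc. -/
def ExpAffineWordDensity : Prop :=
  ∀ W : DobrushinDomain → DobrushinDomain → C(ℂ, ℂ) → Prop, IsExpAffineClosed W →
    ∀ (Δ D : DobrushinDomain) (Φ : C(ℂ, ℂ)), Δ.carrier = Metric.ball (0 : ℂ) 1 → Δ.pt 0 = -1 → Δ.pt 1 = 1 →
      (∃ g : ConformalEquiv (Metric.ball (0 : ℂ) 1) D.carrier, Set.EqOn Φ g (Metric.ball (0 : ℂ) 1)) →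
      D.pt 0 = Φ (-1) → D.pt 1 = Φ 1 →
      ∃ (Dn : ℕ → DobrushinDomain) (Φn : ℕ → C(ℂ, ℂ)),
        (∀ n, W Δ (Dn n) (Φn n)) ∧
        (∀ n, ∃ g : ConformalEquiv (Metric.ball (0 : ℂ) 1) (Dn n).carrier, Set.EqOn (Φn n) g (Metric.ball (0 : ℂ) 1)) ∧
        (∀ n, (Dn n).pt 0 = Φn n (-1) ∧ (Dn n).pt 1 = Φn n 1) ∧
        TendstoUniformlyOn (fun n => ((Φn n : C(ℂ, ℂ)) : ℂ → ℂ)) (Φ : ℂ → ℂ) Filter.atTop (Metric.closedBall (0 : ℂ) 1)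

/-! ### The stubs (the ONLY `sorry`s of this file)

Each stub is stated over TREE VOCABULARY ONLY (the named statements above unfolded by hand), so that it lands
verbatim as a `Theorems/SAWExpCovarianceDensityTheorem<Stub>.lean --supports stmt-CriticalPhenomena-6756`
without importing this workfile (provers need `open MeasureTheory Literature.Probability.RandomPlanarGeometry`
for the registered signature text to elaborate verbatim); the `*_holds` theorems below certify definitionally
that the unfolded text IS the named statement. -/

/-- **S1 — one map per domain is enough (disc reduction).** If `P D = Φ_* (P Δ)` for every unit-disc
Dobrushin domain `Δ` with marked points `∓1`, every Dobrushin `D` and every `Φ : C(ℂ, ℂ)` agreeing on the open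
disc with a conformal equivalence onto `D.carrier` and carrying `∓1` to the marked points of `D`, then `P` is
conformally covariant: given `g : D → D'` with boundary values `a ↦ a'`, `b ↦ b'` and `Φ` agreeing with `g` on
`D`, write `P D = Ψ_* P Δ` for a Riemann map `Ψ` of `D` continuous on the closed disc with `Ψ(∓1) = a, b`
(Riemann + Carathéodory, in the tree; a disc automorphism fixes the two boundary points; Tietze/radial
extension to `ℂ`); then `Φ ∘ Ψ` is again such a map for `D'` (`Φ a = a'` from `HasBoundaryValue` and
continuity), so `P D' = (Φ ∘ Ψ)_* P Δ = Φ_* P D`. True for every `P` (no chordality needed). -/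
theorem stub_discReduction :
    ∀ P : ChordalFamily,
      (∀ (Δ D : DobrushinDomain) (Φ : C(ℂ, ℂ)), Δ.carrier = Metric.ball (0 : ℂ) 1 → Δ.pt 0 = -1 → Δ.pt 1 = 1 →
        (∃ g : ConformalEquiv (Metric.ball (0 : ℂ) 1) D.carrier, Set.EqOn Φ g (Metric.ball (0 : ℂ) 1)) →
        D.pt 0 = Φ (-1) → D.pt 1 = Φ 1 → P D = (P Δ).map (CurveClass.map Φ)) →
      P.IsConformallyCovariant := by
  sorry

/-- **S2 — disc covariance passes to closed-disc-uniform limits.** For a chordal, disc-continuous `P`: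
if disc maps `(Dₙ, Φₙ)` with `P Dₙ = (Φₙ)_* P Δ` converge uniformly on the closed disc to a disc map `(D, Φ)`,
then `P D = Φ_* P Δ`. Disc-continuity gives `∫ f dP Dₙ → ∫ f dP D`; `P Δ` is a probability measure carried by
curves in the closed disc (chordality, `closure (ball 0 1) = closedBall 0 1`), where `Φₙ → Φ` uniformly, so
`CurveClass.map Φₙ γ → CurveClass.map Φ γ` a.s. and `∫ f d(Φₙ)_* P Δ → ∫ f dΦ_* P Δ` (dominated convergence);
two probability measures on the metric space `CurveClass ℂ` with the same integrals of bounded continuous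
functions are equal. -/
theorem stub_discLimitClosure :
    ∀ P : ChordalFamily, P.IsChordal →
      (∀ (Dn : ℕ → DobrushinDomain) (D : DobrushinDomain) (Φn : ℕ → C(ℂ, ℂ)) (Φ : C(ℂ, ℂ)),
        (∀ n, ∃ g : ConformalEquiv (Metric.ball (0 : ℂ) 1) (Dn n).carrier, Set.EqOn (Φn n) g (Metric.ball (0 : ℂ) 1)) →
        (∃ g : ConformalEquiv (Metric.ball (0 : ℂ) 1) D.carrier, Set.EqOn Φ g (Metric.ball (0 : ℂ) 1)) →
        (∀ n, (Dn n).pt 0 = Φn n (-1) ∧ (Dn n).pt 1 = Φn n 1) → D.pt 0 = Φ (-1) → D.pt 1 = Φ 1 →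
        TendstoUniformlyOn (fun n => ((Φn n : C(ℂ, ℂ)) : ℂ → ℂ)) (Φ : ℂ → ℂ) Filter.atTop (Metric.closedBall (0 : ℂ) 1) →
        ∀ f : BoundedContinuousFunction (CurveClass ℂ) ℝ,
          Filter.Tendsto (fun n => ∫ γ, f γ ∂(P (Dn n))) Filter.atTop (nhds (∫ γ, f γ ∂(P D)))) →
      ∀ (Δ : DobrushinDomain) (Dn : ℕ → DobrushinDomain) (D : DobrushinDomain) (Φn : ℕ → C(ℂ, ℂ)) (Φ : C(ℂ, ℂ)),
        Δ.carrier = Metric.ball (0 : ℂ) 1 → Δ.pt 0 = -1 → Δ.pt 1 = 1 →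
        (∀ n, ∃ g : ConformalEquiv (Metric.ball (0 : ℂ) 1) (Dn n).carrier, Set.EqOn (Φn n) g (Metric.ball (0 : ℂ) 1)) →
        (∃ g : ConformalEquiv (Metric.ball (0 : ℂ) 1) D.carrier, Set.EqOn Φ g (Metric.ball (0 : ℂ) 1)) →
        (∀ n, (Dn n).pt 0 = Φn n (-1) ∧ (Dn n).pt 1 = Φn n 1) → D.pt 0 = Φ (-1) → D.pt 1 = Φ 1 →
        TendstoUniformlyOn (fun n => ((Φn n : C(ℂ, ℂ)) : ℂ → ℂ)) (Φ : ℂ → ℂ) Filter.atTop (Metric.closedBall (0 : ℂ) 1) →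
        (∀ n, P (Dn n) = (P Δ).map (CurveClass.map (Φn n))) →
        P D = (P Δ).map (CurveClass.map Φ) := by
  sorry

/-- **S3 (load-bearing, `P`-free) — density of the exp-affine pseudogroup among Riemann maps, uniformly on the
closed disc.** For every relation `W U V Φ` on (Dobrushin domain, Dobrushin domain, plane map) which contains
the similarities `z ↦ c z + w` (`W U (σ U) σ`), the exponential on exp-injective closures (`W U V exp` whenever
`V = (exp U; e^a, e^b)`), the logarithms (`W V U L` for every continuous `L` with `L (exp z) = z` on
`closure U`, same `U, V`), and which is closed under composition, under replacing source and target by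
Dobrushin domains with the same `(carrier, a, b)`, and under changing the map off `closure U`: every `Φ`
agreeing on the open unit disc with a conformal equivalence onto `D.carrier`, with `D.pt 0 = Φ (-1)`,
`D.pt 1 = Φ 1`, is the uniform limit ON THE CLOSED DISC of maps `Φₙ` of the same kind onto Dobrushin domains
`Dₙ` (marked points `Φₙ (∓1)`) with `W Δ Dₙ Φₙ`, for every unit-disc Dobrushin `Δ` with marked points `∓1`.
Route plan: radial Loewner maps with piecewise-constant driving are finite words in similarities, `exp` and
`log` on admissible closed sub-domains (Koebe `z/(1+z)² = ` Möbius ∘ square ∘ Möbius, `1/z = exp (−log z)`,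
`z² = exp (2 log z)`, `√z = exp (½ log z)`); driver continuity (Lawler 2005 Prop. 4.47) and density of slit
maps in class `S` (Lawler 2005 Lemma 4.24, Rem. 4.25; Duren 1983 §3.2–3.3) give words `g_N → ψ` locally
uniformly on the open disc; `Φ_N := g_N (r_N ·)` with `r_N ↑ 1` converges uniformly on the closed disc by
uniform continuity of `Φ` there, and `D_N := Φ_N (𝔻)` is an analytic Jordan domain. -/
theorem stub_expAffineWordDensity :
    ∀ W : DobrushinDomain → DobrushinDomain → C(ℂ, ℂ) → Prop,
      (∀ (U : DobrushinDomain) (c : ℂ) (hc : c ≠ 0) (w : ℂ),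
          W U (U.map (similarity c hc w)) (similarity c hc w : C(ℂ, ℂ))) →
      (∀ (U V : DobrushinDomain), Set.InjOn Complex.exp (closure U.carrier) →
          V.carrier = Complex.exp '' U.carrier → V.pt 0 = Complex.exp (U.pt 0) → V.pt 1 = Complex.exp (U.pt 1) →
            W U V (⟨Complex.exp, Complex.continuous_exp⟩ : C(ℂ, ℂ))) →
      (∀ (U V : DobrushinDomain) (L : C(ℂ, ℂ)), Set.InjOn Complex.exp (closure U.carrier) →
          V.carrier = Complex.exp '' U.carrier → V.pt 0 = Complex.exp (U.pt 0) → V.pt 1 = Complex.exp (U.pt 1) →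
            (∀ z ∈ closure U.carrier, L (Complex.exp z) = z) → W V U L) →
      (∀ (U V V' : DobrushinDomain) (Φ Ψ : C(ℂ, ℂ)), W U V Φ → W V V' Ψ → W U V' (Ψ.comp Φ)) →
      (∀ (U U' V V' : DobrushinDomain) (Φ : C(ℂ, ℂ)), W U V Φ →
          U.carrier = U'.carrier → U.pt 0 = U'.pt 0 → U.pt 1 = U'.pt 1 →
          V.carrier = V'.carrier → V.pt 0 = V'.pt 0 → V.pt 1 = V'.pt 1 → W U' V' Φ) →
      (∀ (U V : DobrushinDomain) (Φ Φ' : C(ℂ, ℂ)), W U V Φ → Set.EqOn Φ Φ' (closure U.carrier) → W U V Φ') →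
      ∀ (Δ D : DobrushinDomain) (Φ : C(ℂ, ℂ)), Δ.carrier = Metric.ball (0 : ℂ) 1 → Δ.pt 0 = -1 → Δ.pt 1 = 1 →
        (∃ g : ConformalEquiv (Metric.ball (0 : ℂ) 1) D.carrier, Set.EqOn Φ g (Metric.ball (0 : ℂ) 1)) →
        D.pt 0 = Φ (-1) → D.pt 1 = Φ 1 →
        ∃ (Dn : ℕ → DobrushinDomain) (Φn : ℕ → C(ℂ, ℂ)),
          (∀ n, W Δ (Dn n) (Φn n)) ∧
          (∀ n, ∃ g : ConformalEquiv (Metric.ball (0 : ℂ) 1) (Dn n).carrier, Set.EqOn (Φn n) g (Metric.ball (0 : ℂ) 1)) ∧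
          (∀ n, (Dn n).pt 0 = Φn n (-1) ∧ (Dn n).pt 1 = Φn n 1) ∧
          TendstoUniformlyOn (fun n => ((Φn n : C(ℂ, ℂ)) : ℂ → ℂ)) (Φ : ℂ → ℂ) Filter.atTop
            (Metric.closedBall (0 : ℂ) 1) := by
  sorry

/-! ### Consistency: each named statement IS its registered stub (definitionally) -/

theorem discReduction_holds : DiscReduction := stub_discReduction
theorem discLimitClosure_holds : DiscLimitClosure := stub_discLimitClosure
theorem expAffineWordDensity_holds : ExpAffineWordDensity :=
  fun W hW => stub_expAffineWordDensity W hW.1 hW.2.1 hW.2.2.1 hW.2.2.2.1 hW.2.2.2.2.1 hW.2.2.2.2.2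

/-! ### Name-keyed aliases of the three statements — the hypotheses of `DensityTheorem_of`

The native skeleton audit (`#h21_check_skeleton`) admits a hypothesis of the skeleton theorem only if its head
constant is a registered obligation or is NAMED like a declared stub; `__Registered.stub_X` is the statement of
`stub_X` under that name (device of `Cruxes/AxiomsOfLimit/Lines/birth.lean`). Each alias is definitionally its
statement. -/
namespace __Registered

/-- Alias of `DiscReduction` keyed by the registered stub name. -/
abbrev stub_discReduction : Prop := DiscReduction
/-- Alias of `DiscLimitClosure` keyed by the registered stub name. -/
abbrev stub_discLimitClosure : Prop := DiscLimitClosure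
/-- Alias of `ExpAffineWordDensity` keyed by the registered stub name. -/
abbrev stub_expAffineWordDensity : Prop := ExpAffineWordDensity

end __Registered

/-! ### Proved glue: push-forward of curve classes, and the closure rules of a covariance class -/

/-- Push-forward of planar curve classes along ANY continuous map of the plane is Borel measurable (indeed
continuous: Heine–Cantor at the compact trace of a curve, Aizenman–Burchard 1999 §2.1; the tree's
`CurveClass.measurable_map` lives on the LSW03 module chain kept out of this route's cone, so the generic
statement is re-proved here exactly as `Theorems.measurable_curveClassMap_exp`). [folklore] -/
theorem measurable_curveClassMap (f : C(ℂ, ℂ)) : Measurable (CurveClass.map f) := by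
  have hcont : Continuous (Curve.map f) := by
    rw [Metric.continuous_iff]
    intro γ₁ ε hε
    have hK := γ₁.isCompact_range.uniformContinuousAt_of_continuousAt f
      (fun a _ ↦ f.continuous.continuousAt) (Metric.dist_mem_uniformity (half_pos hε))
    obtain ⟨δ, hδ, hδε⟩ := Metric.mem_uniformity_dist.1 hK
    refine ⟨δ, hδ, fun γ₂ hγ ↦ ?_⟩
    rw [dist_comm] at hγ ⊢
    obtain ⟨φ, hφ⟩ := Curve.exists_dist_reparam_lt hγ
    refine lt_of_le_of_lt ?_ (half_lt_self hε)
    refine (Curve.reparamDist_le _ _ φ).trans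
      ((ContinuousMap.dist_le (half_pos hε).le).2 fun t ↦ ?_)
    rw [← Curve.map_reparam]
    refine le_of_lt (hδε ?_ ⟨t, rfl⟩)
    exact (ContinuousMap.dist_apply_le_dist (f := γ₁.toContinuousMap)
      (g := (γ₂.reparam φ).toContinuousMap) t).trans_lt hφ
  have h : Continuous (CurveClass.map f) := by
    unfold CurveClass.map
    exact SeparationQuotient.continuous_lift_iff.2 (CurveClass.continuous_mk.comp hcont)
  exact h.measurable

/-- Two continuous maps agreeing on the trace of a curve class push it forward to the same class. [folklore] -/
theorem curveClass_map_congr {f g : C(ℂ, ℂ)} {c : CurveClass ℂ} (h : Set.EqOn f g c.range) :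
    c.map f = c.map g := by
  obtain ⟨γ, rfl⟩ := CurveClass.surjective_mk c
  rw [CurveClass.map_mk, CurveClass.map_mk]
  congr 1
  exact Curve.ext (ContinuousMap.ext fun t =>
    h (show γ t ∈ (CurveClass.mk γ).range from Curve.mem_range.2 ⟨t, rfl⟩))

/-- A continuous map fixing the trace of a curve class pointwise fixes the class. [folklore] -/
theorem curveClass_map_eq_self {f : C(ℂ, ℂ)} {c : CurveClass ℂ} (h : ∀ x ∈ c.range, f x = x) :
    c.map f = c := by
  obtain ⟨γ, rfl⟩ := CurveClass.surjective_mk c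
  rw [CurveClass.map_mk]
  congr 1
  exact Curve.ext (ContinuousMap.ext fun t =>
    h _ (show γ t ∈ (CurveClass.mk γ).range from Curve.mem_range.2 ⟨t, rfl⟩))

section CovClass

variable (P : ChordalFamily)

/-- Closure rule (local) for the covariance class of a chordal family: the push-forward of `P U` only sees the
map on `closure U`. [folklore] -/
theorem cov_local (hch : P.IsChordal) {U V : DobrushinDomain} {Φ Φ' : C(ℂ, ℂ)}
    (h : P V = (P U).map (CurveClass.map Φ)) (heq : Set.EqOn Φ Φ' (closure U.carrier)) :
    P V = (P U).map (CurveClass.map Φ') := by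
  rw [h]
  refine Measure.map_congr ?_
  filter_upwards [(hch U).2] with γ hγ
  exact curveClass_map_congr (heq.mono hγ.2.2)

/-- Closure rule (comp) for the covariance class: `(Ψ ∘ Φ)_* = Ψ_* ∘ Φ_*`. [folklore] -/
theorem cov_comp {U V V' : DobrushinDomain} {Φ Ψ : C(ℂ, ℂ)}
    (h₁ : P V = (P U).map (CurveClass.map Φ)) (h₂ : P V' = (P V).map (CurveClass.map Ψ)) :
    P V' = (P U).map (CurveClass.map (Ψ.comp Φ)) := by
  rw [h₂, h₁, Measure.map_map (measurable_curveClassMap Ψ) (measurable_curveClassMap Φ)]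
  congr 1
  funext c
  show (c.map Φ).map Ψ = c.map (Ψ.comp Φ)
  exact Summit.CriticalPhenomena.SAWScalingLimit.Theorems.curveClass_map_map' Φ Ψ c

/-- Closure rule (log) for the covariance class of a chordal exp-covariant family: if `V = exp U` with `exp`
injective on `closure U`, then `P U = L_* P V` for every continuous `L` inverting `exp` on `closure U`
(`P V = exp_* P U` by hExp, and `L ∘ exp = id` on the traces of `P U`-a.e. curve by chordality). [folklore] -/
theorem cov_log (hch : P.IsChordal)
    (hExp : ∀ (U V : DobrushinDomain), Set.InjOn Complex.exp (closure U.carrier) →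
      V.carrier = Complex.exp '' U.carrier → V.pt 0 = Complex.exp (U.pt 0) → V.pt 1 = Complex.exp (U.pt 1) →
        P V = (P U).map (CurveClass.map (⟨Complex.exp, Complex.continuous_exp⟩ : C(ℂ, ℂ))))
    {U V : DobrushinDomain} {L : C(ℂ, ℂ)}
    (hinj : Set.InjOn Complex.exp (closure U.carrier)) (hc : V.carrier = Complex.exp '' U.carrier)
    (h0 : V.pt 0 = Complex.exp (U.pt 0)) (h1 : V.pt 1 = Complex.exp (U.pt 1))
    (hL : ∀ z ∈ closure U.carrier, L (Complex.exp z) = z) :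
    P U = (P V).map (CurveClass.map L) := by
  rw [hExp U V hinj hc h0 h1, Measure.map_map (measurable_curveClassMap L) (measurable_curveClassMap _)]
  have hae : (CurveClass.map L ∘ CurveClass.map (⟨Complex.exp, Complex.continuous_exp⟩ : C(ℂ, ℂ)))
      =ᵐ[P U] id := by
    filter_upwards [(hch U).2] with γ hγ
    show (γ.map _).map L = γ
    rw [Summit.CriticalPhenomena.SAWScalingLimit.Theorems.curveClass_map_map']
    exact curveClass_map_eq_self fun x hx => hL x (hγ.2.2 hx)
  rw [Measure.map_congr hae, Measure.map_id]

/-- The covariance class `W_P U V Φ := (P V = Φ_* P U)` of a chordal, carrier-determined, similarity- and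
exp-covariant family obeys the six closure rules of S3. [folklore] -/
theorem isExpAffineClosed_cov (hch : P.IsChordal) (hCD : CarrierDetermined P)
    (hSim : P.IsSimilarityCovariant) (hExp : ExpCovariant P) :
    IsExpAffineClosed (fun U V Φ => P V = (P U).map (CurveClass.map Φ)) := by
  refine ⟨fun U c hc w => hSim U c hc w, hExp, ?_, ?_, ?_, ?_⟩
  · intro U V L hinj hc h0 h1 hL
    exact cov_log P hch hExp hinj hc h0 h1 hL
  · intro U V V' Φ Ψ hA hB
    exact cov_comp P hA hB
  · intro U U' V V' Φ hUV hU hU0 hU1 hV hV0 hV1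
    show P V' = (P U').map (CurveClass.map Φ)
    rw [← hCD V V' hV hV0 hV1, ← hCD U U' hU hU0 hU1]
    exact hUV
  · intro U V Φ Φ' hUV heq
    exact cov_local P hch hUV heq

end CovClass

/-! ### The skeleton theorem: the three stubs imply the crux, BY NAME -/

/-- **`DensityTheorem` from the line `birth`** (kernel-checked, no `sorry` of its own). Upgrade hSim to all
complex similarities by the tree theorem `rotationsFromExp_proof` (support item RotationsFromExp); the
covariance class of `P` is exp-affine closed (`isExpAffineClosed_cov`); S3 approximates every disc map by
covariant disc maps uniformly on the closed disc; S2 passes covariance to the limit; S1 turns disc covariance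
into conformal covariance. Hypotheses = the three stubs under their registered names; conclusion = the route
decl, by name. -/
theorem DensityTheorem_of (h₁ : __Registered.stub_discReduction) (h₂ : __Registered.stub_discLimitClosure)
    (h₃ : __Registered.stub_expAffineWordDensity) :
    Summit.CriticalPhenomena.SAWScalingLimit.Theses.SAWExpCovariance.DensityTheorem := by
  intro P hch hCD hSim hExp hDC
  have hSimC : P.IsSimilarityCovariant :=
    Summit.CriticalPhenomena.SAWScalingLimit.Theorems.rotationsFromExp_proof P hch hCD hSim hExp
  have hW : IsExpAffineClosed (fun U V Φ => P V = (P U).map (CurveClass.map Φ)) :=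
    isExpAffineClosed_cov P hch hCD hSimC hExp
  refine h₁ P ?_
  intro Δ D Φ hΔ hΔ0 hΔ1 hg hD0 hD1
  obtain ⟨Dn, Φn, hcov, hgn, hpt, hunif⟩ := h₃ _ hW Δ D Φ hΔ hΔ0 hΔ1 hg hD0 hD1
  exact h₂ P hch hDC Δ Dn D Φn Φ hΔ hΔ0 hΔ1 hgn hg hpt hD0 hD1 hunif hcov

/-- Wiring check (an `example`, so that `DensityTheorem_of` stays the only theorem concluding the crux): the
registered stubs, with their tree-vocabulary types, feed the skeleton theorem as stated — this term becomes the
crux proof when the three `sorry`s above are discharged. -/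
example : Summit.CriticalPhenomena.SAWScalingLimit.Theses.SAWExpCovariance.DensityTheorem :=
  DensityTheorem_of stub_discReduction stub_discLimitClosure
    (fun W hW => stub_expAffineWordDensity W hW.1 hW.2.1 hW.2.2.1 hW.2.2.2.1 hW.2.2.2.2.1 hW.2.2.2.2.2)

end Summit.CriticalPhenomena.SAWScalingLimit.Cruxes.DensityTheorem.Birth

end
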